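import Mathlib
import HarnessLib
import Summits.HubbardSuperconductivity.HubbardSuperconductivity.Theorems.KLProgrammeC4aCausticSignPair
import Summits.HubbardSuperconductivity.HubbardSuperconductivity.Theorems.KLProgrammeC4aCausticPairLayerRemainder

/-!
# Route `KLProgramme` — crux C4a, S3 brick (B4) «(B4)-UMK1», «(M2)-DISPATCH» part 2: the caustic pair ϑ-layer on a FIXED window with the laws routed by the SIGN
# of the offset — the zero pair is internal (part 1), so the (U1) assembly never locates a zero of `δ₀(·;θ)`, never splits on the side of the antipodal-umklapp
# touch, and a window edge inside the post-caustic gap is allowed; plus the fully θ-free twin with the logarithmic remainder majorised internally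

Cell `gate-hubbard-kl`, seat hubbard-kl-k3c3-p3 (g29; row «implicit-function / monotonicity route for μ(n)»).  Located brick for the (C)-closer lane hubbard-kl-c4a-1
(stub (C) `stub_twoLeg_curvature` of `KLRegimeEngineV17F2`, stmt-HubbardSuperconductivity-20437), memo HOME/hubbard-kl-k3c3-p3/U1-CAUSTIC-SUP.md §7 (M2)/(M4).
`…C4aCausticPairLayer(Remainder).intervalIntegral_caustic_pair(_remainder)_le` lives on a window `[c₁ − δ, c₂ + δ]` keyed to the ZEROS of the offset and routes the two
laws by POSITION; the laws themselves (pre: `…C4aPreCausticAngleLayer`, post: `…C4aFoldLevelLayerSharp`) are naturally keyed to the SIGN of `δ₀(ϑ)`.  This file: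
* §1 `intervalIntegral_le_of_majorant_Ioo` (piece comparison without integrability of `F`) and the engine **`intervalIntegral_caustic_dispatch_le_of_signPair`** (the
  four-piece majorant argument of the pair layer on `[α,e₁] ∪ [e₁,mid] ∪ [mid,e₂] ∪ [e₂,β]`, a remainder riding along, the laws asked only off `e₁, e₂`);
* §1 **`intervalIntegral_caustic_dispatch_remainder_le`** / `intervalIntegral_caustic_dispatch_le`: fixed window `[α,β]`, `m` continuous with `m − (κ/2)(·)²` convex,
  `F ≥ 0`, the one-sided pre-caustic law WHERE `m ϑ > 0` and the log-free post-caustic law WHERE `m ϑ < 0` (points of `Ioo α β` only) ⟹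
  `∫_α^β F ≤ (8A + 4P)/√(κ/2) + B(β − α) + ∫_α^β R` — uniform in `lo`, in the zeros and in the gap;
* §2 **`intervalIntegral_caustic_dispatch_log_le`**: the same with the logarithmic remainder `B′·log(Γ/|m ϑ|)` of the pre-caustic angle layer, majorised INTERNALLY at
  the sign pair (`…Remainder.log_offset_le_rpow_sum`, two inverse square roots, `intervalIntegrable_abs_sub_rpow_neg_half`) ⟹ `… + B′·2(Γ/(κ/2))^{1/4}·8√(β − α)`.
So (M4) calls ONE theorem per ϑ-window with the directional Hessian floor (M2, via `convexOn_sub_sq_of_line_deriv2`) and the two laws; nothing θ-dependent is located.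
Pure real analysis; nothing about the model; nothing asserts (C), K3 or superconductivity.
References: Salmhofer 1999 §4.5.3 [cite: Salmhofer1999]; FST II CPAM 51 (1998) §3 [cite: FeldmanSalmhoferTrubowitz1998].
-/

noncomputable section

namespace Summit.HubbardSuperconductivity.HubbardSuperconductivity.Theorems.C4a

set_option linter.dupNamespace false -- summit = problem name (single-conjunct summit), D-0017

open Real Set MeasureTheory intervalIntegral

/-! ## §1 The dispatcher: the pair layer on a fixed window, laws routed by the sign of the offset -/

/-- Comparison on one piece: `F ≥ 0` and `F ≤ G + R` on `Ioo p q`, `G, R` interval-integrable ⟹ `∫_p^q F ≤ ∫_p^q G + ∫_p^q R` (no integrability of `F`). -/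
theorem intervalIntegral_le_of_majorant_Ioo {F G R : ℝ → ℝ} {p q : ℝ} (hpq : p ≤ q)
    (hF0 : ∀ ϑ ∈ Ioo p q, 0 ≤ F ϑ) (hG : IntervalIntegrable G volume p q) (hR : IntervalIntegrable R volume p q)
    (hle : ∀ ϑ ∈ Ioo p q, F ϑ ≤ G ϑ + R ϑ) :
    ∫ ϑ in p..q, F ϑ ≤ (∫ ϑ in p..q, G ϑ) + ∫ ϑ in p..q, R ϑ := by
  rw [← intervalIntegral.integral_add hG hR, intervalIntegral.integral_of_le hpq, intervalIntegral.integral_of_le hpq,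
    integral_Ioc_eq_integral_Ioo, integral_Ioc_eq_integral_Ioo]
  refine integral_mono_of_nonneg ?_ ((hG.add hR).1.mono_set Ioo_subset_Ioc_self) ?_
  · exact (ae_restrict_iff' measurableSet_Ioo).2 (Filter.Eventually.of_forall fun ϑ hϑ => hF0 ϑ hϑ)
  · exact (ae_restrict_iff' measurableSet_Ioo).2 (Filter.Eventually.of_forall fun ϑ hϑ => hle ϑ hϑ)

/-- **THE DISPATCHER, GIVEN A SIGN PAIR** (the engine of §1–§2).  `α ≤ e₁ ≤ e₂ ≤ β`, `0 < b`, `0 < lo`, `A, P, B ≥ 0`; on `Ioo α e₁` and `Ioo e₂ β` the offset is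
positive with the outside product floors, on `Ioo e₁ e₂` negative with the inside ceiling (the data of `exists_signPair_of_convexOn_sub_sq`, `b = κ/2`); `F ≥ 0` and
`R ≥ 0` on `[α,β]`, `R` interval-integrable; the pre law WHERE `0 < m` and the post law WHERE `m < 0`, asked only at points of `Ioo α β` other than `e₁, e₂`.  THEN
`∫_α^β F ≤ (8A + 4P)/√b + B·(β − α) + ∫_α^β R`.  Same four-piece majorant argument as `…C4aCausticPairLayer.intervalIntegral_caustic_pair_le`, on `[α,e₁]`,
`[e₁,mid]`, `[mid,e₂]`, `[e₂,β]`, the remainder riding along. -/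
theorem intervalIntegral_caustic_dispatch_le_of_signPair {F m R : ℝ → ℝ} {α β e₁ e₂ b lo A P B : ℝ}
    (hαe : α ≤ e₁) (h12 : e₁ ≤ e₂) (heβ : e₂ ≤ β) (hb : 0 < b) (hlo : 0 < lo) (hA : 0 ≤ A) (hP : 0 ≤ P) (hB : 0 ≤ B)
    (hleft : ∀ ϑ ∈ Ioo α e₁, 0 < m ϑ ∧ b * (e₁ - ϑ) * (e₂ - ϑ) ≤ m ϑ)
    (hright : ∀ ϑ ∈ Ioo e₂ β, 0 < m ϑ ∧ b * (ϑ - e₁) * (ϑ - e₂) ≤ m ϑ)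
    (hin : ∀ ϑ ∈ Ioo e₁ e₂, m ϑ < 0 ∧ m ϑ ≤ -(b * (ϑ - e₁) * (e₂ - ϑ)))
    (hF0 : ∀ ϑ ∈ Icc α β, 0 ≤ F ϑ)
    (hR0 : ∀ ϑ ∈ Icc α β, 0 ≤ R ϑ) (hRi : IntervalIntegrable R volume α β)
    (hpre : ∀ ϑ ∈ Ioo α β, ϑ ≠ e₁ → ϑ ≠ e₂ → 0 < m ϑ →
      F ϑ ≤ A * (lo * ((max |m ϑ| lo)⁻¹ * (Real.sqrt (max |m ϑ| lo))⁻¹)) + B + R ϑ)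
    (hpost : ∀ ϑ ∈ Ioo α β, ϑ ≠ e₁ → ϑ ≠ e₂ → m ϑ < 0 → F ϑ ≤ P * (Real.sqrt |m ϑ|)⁻¹ + B + R ϑ) :
    ∫ ϑ in α..β, F ϑ ≤ (8 * A + 4 * P) / Real.sqrt b + B * (β - α) + ∫ ϑ in α..β, R ϑ := by
  have hαβ : α ≤ β := (hαe.trans h12).trans heβ
  have hsb : 0 < Real.sqrt b := Real.sqrt_pos.2 hb
  -- integrability of `R` on the four pieces
  have hRsub : ∀ p q : ℝ, α ≤ p → p ≤ q → q ≤ β → IntervalIntegrable R volume p q := fun p q hp hpq hq =>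
    hRi.mono_set (by rw [uIcc_of_le hpq, uIcc_of_le hαβ]; exact Icc_subset_Icc hp hq)
  set h : ℝ := (e₂ - e₁) / 2 with hh
  have hh0 : 0 ≤ h := by rw [hh]; linarith
  set mid : ℝ := e₁ + h with hmid
  have hmid' : mid = e₂ - h := by rw [hmid, hh]; ring
  have hmid1 : e₁ ≤ mid := by rw [hmid]; linarith
  have hmid2 : mid ≤ e₂ := by rw [hmid']; linarith
  have hR1 := hRsub α e₁ le_rfl hαe (h12.trans heβ)
  have hR2 := hRsub e₁ mid hαe hmid1 (hmid2.trans heβ)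
  have hR3 := hRsub mid e₂ (hαe.trans hmid1) hmid2 heβ
  have hR4 := hRsub e₂ β (hαe.trans h12) heβ le_rfl
  -- the pre-side majorant `gpre x = A·8lo/(√b x + √lo)³ + B` and its integral on `[0, L]`
  set gpre : ℝ → ℝ := fun x => A * (8 * lo / (Real.sqrt b * x + Real.sqrt lo) ^ 3) + B with hgpre
  have hq : ∀ x : ℝ, 0 ≤ x → 0 < Real.sqrt b * x + Real.sqrt lo := fun x hx => by
    have : 0 ≤ Real.sqrt b * x := mul_nonneg hsb.le hx
    have := Real.sqrt_pos.2 hlo; linarith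
  have hgpre_cont : ∀ L : ℝ, ContinuousOn gpre (Icc 0 L) := fun L => by
    refine (ContinuousOn.const_mul (ContinuousOn.div continuousOn_const
      ((continuousOn_const.mul continuousOn_id).add continuousOn_const |>.pow 3) fun x hx => ?_) A).add continuousOn_const
    exact pow_ne_zero 3 (hq x hx.1).ne'
  have hgpre_int : ∀ L : ℝ, 0 ≤ L → IntervalIntegrable gpre volume 0 L := fun L hL => by
    rw [intervalIntegrable_iff_integrableOn_Icc_of_le hL]
    exact (hgpre_cont L).integrableOn_compact isCompact_Icc
  have hgpre_val : ∀ L : ℝ, 0 ≤ L → ∫ x in (0 : ℝ)..L, gpre x ≤ A * (4 / Real.sqrt b) + B * L := fun L hL => by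
    have hi : IntervalIntegrable (fun x : ℝ => 8 * lo / (Real.sqrt b * x + Real.sqrt lo) ^ 3) volume 0 L := by
      rw [intervalIntegrable_iff_integrableOn_Icc_of_le hL]
      refine ContinuousOn.integrableOn_compact isCompact_Icc ?_
      refine ContinuousOn.div continuousOn_const ((continuousOn_const.mul continuousOn_id).add continuousOn_const |>.pow 3) fun x hx => ?_
      exact pow_ne_zero 3 (hq x hx.1).ne'
    simp only [hgpre]
    rw [intervalIntegral.integral_add (hi.const_mul A) intervalIntegrable_const, intervalIntegral.integral_const_mul,
      intervalIntegral.integral_const, sub_zero, smul_eq_mul]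
    have h1 := intervalIntegral_pre_majorant_le hlo hb hL
    nlinarith [h1, hA, mul_comm L B]
  -- pointwise pre-side bound in distance form: `0 < m ϑ`, `b x² ≤ m ϑ` ⟹ `F ϑ ≤ gpre x + R ϑ`
  have hpre_pt : ∀ ϑ ∈ Ioo α β, ϑ ≠ e₁ → ϑ ≠ e₂ → ∀ x : ℝ, 0 ≤ x → 0 < m ϑ → b * x ^ 2 ≤ m ϑ → F ϑ ≤ gpre x + R ϑ :=
    fun ϑ hϑ hn1 hn2 x hx hmpos hbx => by
    have h1 := hpre ϑ hϑ hn1 hn2 hmpos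
    have hbx' : b * x ^ 2 ≤ |m ϑ| := hbx.trans (le_abs_self _)
    have h2 := pre_majorant_le hlo hb hx hbx'
    simp only [hgpre]
    have := mul_le_mul_of_nonneg_left h2 hA
    linarith
  -- piece 4: `[e₂, β]`, `x = ϑ − e₂`
  have hp4 : ∫ ϑ in e₂..β, F ϑ ≤ A * (4 / Real.sqrt b) + B * (β - e₂) + ∫ ϑ in e₂..β, R ϑ := by
    have hL : 0 ≤ β - e₂ := sub_nonneg.2 heβ
    have hmi : IntervalIntegrable (fun ϑ => gpre (ϑ - e₂)) volume e₂ β := by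
      have h := (hgpre_int (β - e₂) hL).comp_sub_right e₂
      simp only [zero_add, sub_add_cancel] at h
      exact h
    have hle := intervalIntegral_le_of_majorant_Ioo heβ (fun ϑ hϑ => hF0 ϑ ⟨by linarith [hϑ.1, h12], hϑ.2.le⟩) hmi hR4
      (fun ϑ hϑ => by
        have hx : 0 < ϑ - e₂ := by linarith [hϑ.1]
        have hϑO : ϑ ∈ Ioo α β := ⟨by linarith [hϑ.1, h12], hϑ.2⟩
        obtain ⟨hmpos, hfl⟩ := hright ϑ hϑ
        refine hpre_pt ϑ hϑO (by intro h'; linarith) (ne_of_gt hϑ.1) (ϑ - e₂) hx.le hmpos ?_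
        calc b * (ϑ - e₂) ^ 2 = b * (ϑ - e₂) * (ϑ - e₂) := by ring
          _ ≤ b * (ϑ - e₁) * (ϑ - e₂) := by
              exact mul_le_mul_of_nonneg_right (mul_le_mul_of_nonneg_left (by linarith) hb.le) hx.le
          _ ≤ m ϑ := hfl)
    refine hle.trans ?_
    rw [intervalIntegral.integral_comp_sub_right gpre e₂, sub_self]
    linarith [hgpre_val (β - e₂) hL]
  -- piece 1: `[α, e₁]`, `x = e₁ − ϑ`
  have hp1 : ∫ ϑ in α..e₁, F ϑ ≤ A * (4 / Real.sqrt b) + B * (e₁ - α) + ∫ ϑ in α..e₁, R ϑ := by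
    have hL : 0 ≤ e₁ - α := sub_nonneg.2 hαe
    have hmi : IntervalIntegrable (fun ϑ => gpre (e₁ - ϑ)) volume α e₁ := by
      have h := ((hgpre_int (e₁ - α) hL).comp_sub_left e₁).symm
      simp only [sub_zero, sub_sub_cancel] at h
      exact h
    have hle := intervalIntegral_le_of_majorant_Ioo hαe (fun ϑ hϑ => hF0 ϑ ⟨hϑ.1.le, by linarith [hϑ.2, h12]⟩) hmi hR1
      (fun ϑ hϑ => by
        have hx : 0 < e₁ - ϑ := by linarith [hϑ.2]
        have hϑO : ϑ ∈ Ioo α β := ⟨hϑ.1, by linarith [hϑ.2, h12]⟩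
        obtain ⟨hmpos, hfl⟩ := hleft ϑ hϑ
        refine hpre_pt ϑ hϑO (ne_of_lt hϑ.2) ?_ (e₁ - ϑ) hx.le hmpos ?_
        · intro h'; linarith
        calc b * (e₁ - ϑ) ^ 2 = b * (e₁ - ϑ) * (e₁ - ϑ) := by ring
          _ ≤ b * (e₁ - ϑ) * (e₂ - ϑ) := by
              exact mul_le_mul_of_nonneg_left (by linarith) (by positivity)
          _ ≤ m ϑ := hfl)
    refine hle.trans ?_
    rw [intervalIntegral.integral_comp_sub_left gpre e₁, sub_self]
    linarith [hgpre_val (e₁ - α) hL]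
  -- the two inner halves
  have hinner : (∫ ϑ in e₁..mid, F ϑ) + ∫ ϑ in mid..e₂, F ϑ ≤
      P * (4 / Real.sqrt b) + B * (e₂ - e₁) + ((∫ ϑ in e₁..mid, R ϑ) + ∫ ϑ in mid..e₂, R ϑ) := by
    rcases eq_or_lt_of_le hh0 with hz | hpos
    · -- degenerate gap: both inner integrals vanish
      have he0 : e₂ = e₁ := by
        have h2 : (e₂ - e₁) / 2 = 0 := by rw [← hh]; exact hz.symm
        linarith
      have hm0 : mid = e₁ := by rw [hmid, ← hz, add_zero]
      rw [hm0, he0]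
      simp only [intervalIntegral.integral_same, sub_self, mul_zero, add_zero]
      positivity
    · set gpost : ℝ → ℝ := fun x => P * ((Real.sqrt (b * h))⁻¹ * x ^ (-(1 / 2) : ℝ)) + B with hgpost
      have hgpost_int : ∀ p q : ℝ, IntervalIntegrable gpost volume p q := fun p q =>
        ((intervalIntegral.intervalIntegrable_rpow' (by norm_num)).const_mul _ |>.const_mul P).add intervalIntegrable_const
      have hgpost_val : ∫ x in (0 : ℝ)..h, gpost x = P * (2 / Real.sqrt b) + B * h := by
        simp only [hgpost]
        rw [intervalIntegral.integral_add (((intervalIntegral.intervalIntegrable_rpow' (by norm_num)).const_mul _).const_mul P)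
          intervalIntegrable_const, intervalIntegral.integral_const_mul, intervalIntegral_post_majorant hb hpos, intervalIntegral.integral_const,
          sub_zero, smul_eq_mul, mul_comm h B]
      have hpost_pt : ∀ ϑ ∈ Ioo e₁ e₂, ∀ x : ℝ, 0 < x → b * h * x ≤ |m ϑ| → F ϑ ≤ gpost x + R ϑ := fun ϑ hϑ x hx hbx => by
        have hϑO : ϑ ∈ Ioo α β := ⟨lt_of_le_of_lt hαe hϑ.1, lt_of_lt_of_le hϑ.2 heβ⟩
        have h1 := hpost ϑ hϑO (ne_of_gt hϑ.1) (ne_of_lt hϑ.2) (hin ϑ hϑ).1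
        have h2 := post_majorant_le hb hpos hx hbx
        simp only [hgpost]
        have := mul_le_mul_of_nonneg_left h2 hP
        linarith
      have hmm : ∀ ϑ ∈ Ioo e₁ e₂, b * (ϑ - e₁) * (e₂ - ϑ) ≤ |m ϑ| := fun ϑ hϑ => by
        have hc := (hin ϑ hϑ).2
        calc b * (ϑ - e₁) * (e₂ - ϑ) ≤ -m ϑ := by linarith [hc]
          _ ≤ |m ϑ| := neg_le_abs _
      -- left inner half `[e₁, mid]`, `x = ϑ − e₁`, `e₂ − ϑ ≥ h`
      have hL : ∫ ϑ in e₁..mid, F ϑ ≤ P * (2 / Real.sqrt b) + B * h + ∫ ϑ in e₁..mid, R ϑ := by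
        have hmi : IntervalIntegrable (fun ϑ => gpost (ϑ - e₁)) volume e₁ mid := by
          have h := (hgpost_int (e₁ - e₁) (mid - e₁)).comp_sub_right e₁
          simp only [sub_add_cancel] at h
          exact h
        have hle := intervalIntegral_le_of_majorant_Ioo hmid1
          (fun ϑ hϑ => hF0 ϑ ⟨by linarith [hϑ.1], by linarith [hϑ.2, hmid2]⟩) hmi hR2
          (fun ϑ hϑ => by
            have hx : 0 < ϑ - e₁ := by linarith [hϑ.1]
            have h2ϑ : h ≤ e₂ - ϑ := by rw [hmid'] at hϑ; linarith [hϑ.2]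
            have hϑ2 : ϑ < e₂ := by linarith
            refine hpost_pt ϑ ⟨hϑ.1, hϑ2⟩ (ϑ - e₁) hx ?_
            calc b * h * (ϑ - e₁) = b * (ϑ - e₁) * h := by ring
              _ ≤ b * (ϑ - e₁) * (e₂ - ϑ) := mul_le_mul_of_nonneg_left h2ϑ (by positivity)
              _ ≤ |m ϑ| := hmm ϑ ⟨hϑ.1, hϑ2⟩)
        refine hle.trans (le_of_eq ?_)
        rw [intervalIntegral.integral_comp_sub_right gpost e₁, sub_self, show mid - e₁ = h by rw [hmid]; ring, hgpost_val]
      -- right inner half `[mid, e₂]`, `x = e₂ − ϑ`, `ϑ − e₁ ≥ h`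
      have hR : ∫ ϑ in mid..e₂, F ϑ ≤ P * (2 / Real.sqrt b) + B * h + ∫ ϑ in mid..e₂, R ϑ := by
        have hmi : IntervalIntegrable (fun ϑ => gpost (e₂ - ϑ)) volume mid e₂ := by
          have h := (hgpost_int (e₂ - mid) (e₂ - e₂)).comp_sub_left e₂
          simpa using h
        have hle := intervalIntegral_le_of_majorant_Ioo hmid2
          (fun ϑ hϑ => hF0 ϑ ⟨by linarith [hϑ.1, hmid1], by linarith [hϑ.2]⟩) hmi hR3
          (fun ϑ hϑ => by
            have hx : 0 < e₂ - ϑ := by linarith [hϑ.2]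
            have h1ϑ : h ≤ ϑ - e₁ := by rw [hmid] at hϑ; linarith [hϑ.1]
            have hϑ1 : e₁ < ϑ := by linarith
            refine hpost_pt ϑ ⟨hϑ1, hϑ.2⟩ (e₂ - ϑ) hx ?_
            calc b * h * (e₂ - ϑ) ≤ b * (ϑ - e₁) * (e₂ - ϑ) :=
                  mul_le_mul_of_nonneg_right (mul_le_mul_of_nonneg_left h1ϑ hb.le) hx.le
              _ ≤ |m ϑ| := hmm ϑ ⟨hϑ1, hϑ.2⟩)
        refine hle.trans (le_of_eq ?_)
        rw [intervalIntegral.integral_comp_sub_left gpost e₂, sub_self, show e₂ - mid = h by rw [hmid']; ring, hgpost_val]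
      have hh2 : B * (e₂ - e₁) = 2 * (B * h) := by rw [hh]; ring
      have hP2 : P * (4 / Real.sqrt b) = 2 * (P * (2 / Real.sqrt b)) := by ring
      rw [hh2, hP2]
      linarith [hL, hR]
  -- assemble: split `∫ F` and `∫ R` at `e₁`, `mid`, `e₂`
  by_cases hint : IntervalIntegrable F volume α β
  swap
  · rw [intervalIntegral.integral_undef hint]
    have hRnn : 0 ≤ ∫ ϑ in α..β, R ϑ := intervalIntegral.integral_nonneg hαβ hR0
    have h1 : 0 ≤ (8 * A + 4 * P) / Real.sqrt b := by positivity
    have h2 : 0 ≤ B * (β - α) := mul_nonneg hB (sub_nonneg.2 hαβ)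
    linarith
  have hsub : ∀ p q : ℝ, α ≤ p → p ≤ q → q ≤ β → IntervalIntegrable F volume p q := fun p q hp hpq hq =>
    hint.mono_set (by rw [uIcc_of_le hpq, uIcc_of_le hαβ]; exact Icc_subset_Icc hp hq)
  have hi1 := hsub α e₁ le_rfl hαe (h12.trans heβ)
  have hi2 := hsub e₁ mid hαe hmid1 (hmid2.trans heβ)
  have hi3 := hsub mid e₂ (hαe.trans hmid1) hmid2 heβ
  have hi4 := hsub e₂ β (hαe.trans h12) heβ le_rfl
  rw [← integral_add_adjacent_intervals hi1 ((hi2.trans hi3).trans hi4), ← integral_add_adjacent_intervals hi2 (hi3.trans hi4),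
    ← integral_add_adjacent_intervals hi3 hi4,
    ← integral_add_adjacent_intervals hR1 ((hR2.trans hR3).trans hR4), ← integral_add_adjacent_intervals hR2 (hR3.trans hR4),
    ← integral_add_adjacent_intervals hR3 hR4]
  have htot : (8 * A + 4 * P) / Real.sqrt b + B * (β - α) =
      (A * (4 / Real.sqrt b) + B * (e₁ - α)) + ((P * (4 / Real.sqrt b) + B * (e₂ - e₁)) + (A * (4 / Real.sqrt b) + B * (β - e₂))) := by
    field_simp; ring
  rw [htot]
  linarith [hp1, hp4, hinner]

/-- **THE DISPATCHER (with an integrable remainder).**  Fixed window `α ≤ β`; `0 < κ`, `0 < lo`, `A, P, B ≥ 0`; the offset `m` is continuous on `[α,β]` with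
`m − (κ/2)(·)²` convex (strong convexity, modulus `κ`, derivative-free); `F ≥ 0` on `[α,β]`; a remainder `R ≥ 0` on `[α,β]`, interval-integrable; and, at points of
`Ioo α β` only, the ONE-SIDED PRE-CAUSTIC law `F ϑ ≤ A·lo·(max |m ϑ| lo)⁻¹·(√(max |m ϑ| lo))⁻¹ + B + R ϑ` WHERE `0 < m ϑ` and the LOG-FREE post-caustic law
`F ϑ ≤ P·(√|m ϑ|)⁻¹ + B + R ϑ` WHERE `m ϑ < 0` (nothing at the ≤ 2 zeros).  THEN
`∫_α^β F ≤ (8A + 4P)/√(κ/2) + B·(β − α) + ∫_α^β R` — uniform in `lo`, in the position of the zeros and in the gap; the zero pair is never named. -/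
theorem intervalIntegral_caustic_dispatch_remainder_le {F m R : ℝ → ℝ} {α β κ lo A P B : ℝ} (hαβ : α ≤ β) (hκ : 0 < κ) (hlo : 0 < lo)
    (hA : 0 ≤ A) (hP : 0 ≤ P) (hB : 0 ≤ B)
    (hφ : ConvexOn ℝ (Icc α β) (fun ϑ => m ϑ - κ / 2 * ϑ ^ 2)) (hcont : ContinuousOn m (Icc α β))
    (hF0 : ∀ ϑ ∈ Icc α β, 0 ≤ F ϑ)
    (hR0 : ∀ ϑ ∈ Icc α β, 0 ≤ R ϑ) (hRi : IntervalIntegrable R volume α β)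
    (hpre : ∀ ϑ ∈ Ioo α β, 0 < m ϑ →
      F ϑ ≤ A * (lo * ((max |m ϑ| lo)⁻¹ * (Real.sqrt (max |m ϑ| lo))⁻¹)) + B + R ϑ)
    (hpost : ∀ ϑ ∈ Ioo α β, m ϑ < 0 → F ϑ ≤ P * (Real.sqrt |m ϑ|)⁻¹ + B + R ϑ) :
    ∫ ϑ in α..β, F ϑ ≤ (8 * A + 4 * P) / Real.sqrt (κ / 2) + B * (β - α) + ∫ ϑ in α..β, R ϑ := by
  obtain ⟨e₁, e₂, hαe, h12, heβ, hleft, hright, hin, -⟩ := exists_signPair_of_convexOn_sub_sq hαβ hκ hφ hcont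
  exact intervalIntegral_caustic_dispatch_le_of_signPair hαe h12 heβ (by positivity) hlo hA hP hB
    (fun ϑ hϑ => hleft ϑ ⟨hϑ.1.le, hϑ.2.le.trans (h12.trans heβ)⟩ hϑ.2)
    (fun ϑ hϑ => hright ϑ ⟨(hαe.trans h12).trans hϑ.1.le, hϑ.2.le⟩ hϑ.1)
    hin hF0 hR0 hRi (fun ϑ hϑ _ _ hm => hpre ϑ hϑ hm) (fun ϑ hϑ _ _ hm => hpost ϑ hϑ hm)

/-- **THE DISPATCHER (constant remainder only).**  As `intervalIntegral_caustic_dispatch_remainder_le` with `R = 0`: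
`∫_α^β F ≤ (8A + 4P)/√(κ/2) + B·(β − α)`. -/
theorem intervalIntegral_caustic_dispatch_le {F m : ℝ → ℝ} {α β κ lo A P B : ℝ} (hαβ : α ≤ β) (hκ : 0 < κ) (hlo : 0 < lo)
    (hA : 0 ≤ A) (hP : 0 ≤ P) (hB : 0 ≤ B)
    (hφ : ConvexOn ℝ (Icc α β) (fun ϑ => m ϑ - κ / 2 * ϑ ^ 2)) (hcont : ContinuousOn m (Icc α β))
    (hF0 : ∀ ϑ ∈ Icc α β, 0 ≤ F ϑ)
    (hpre : ∀ ϑ ∈ Ioo α β, 0 < m ϑ →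
      F ϑ ≤ A * (lo * ((max |m ϑ| lo)⁻¹ * (Real.sqrt (max |m ϑ| lo))⁻¹)) + B)
    (hpost : ∀ ϑ ∈ Ioo α β, m ϑ < 0 → F ϑ ≤ P * (Real.sqrt |m ϑ|)⁻¹ + B) :
    ∫ ϑ in α..β, F ϑ ≤ (8 * A + 4 * P) / Real.sqrt (κ / 2) + B * (β - α) := by
  have h := intervalIntegral_caustic_dispatch_remainder_le (R := fun _ => 0) hαβ hκ hlo hA hP hB hφ hcont hF0
    (fun _ _ => le_rfl) intervalIntegrable_const (fun ϑ hϑ hm => by simpa using hpre ϑ hϑ hm)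
    (fun ϑ hϑ hm => by simpa using hpost ϑ hϑ hm)
  simpa using h

/-! ## §2 The dispatcher with the logarithmic remainder of the pre-caustic angle layer (fully θ-free) -/

/-- `|ϑ − c|^{−1/2}` is interval-integrable on every interval. -/
theorem intervalIntegrable_abs_sub_rpow_neg_half (c p q : ℝ) :
    IntervalIntegrable (fun ϑ : ℝ => |ϑ - c| ^ (-(1 / 2) : ℝ)) volume p q := by
  have hr : (-1 : ℝ) < -(1 / 2) := by norm_num
  have key : ∀ p' q' : ℝ, p' ≤ q' → q' ≤ c → IntervalIntegrable (fun ϑ : ℝ => |ϑ - c| ^ (-(1 / 2) : ℝ)) volume p' q' := by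
    intro p' q' hp'q' hq'c
    have h := ((intervalIntegral.intervalIntegrable_rpow' hr (a := c - q') (b := c - p')).comp_sub_left c)
    simp only [sub_sub_cancel] at h
    refine (h.symm).congr ?_
    rw [uIoc_of_le hp'q']
    intro ϑ hϑ
    simp only [abs_of_nonpos (show ϑ - c ≤ 0 by linarith [hϑ.2]), neg_sub]
  have key' : ∀ p' q' : ℝ, p' ≤ q' → c ≤ p' → IntervalIntegrable (fun ϑ : ℝ => |ϑ - c| ^ (-(1 / 2) : ℝ)) volume p' q' := by
    intro p' q' hp'q' hcp'
    have h := ((intervalIntegral.intervalIntegrable_rpow' hr (a := p' - c) (b := q' - c)).comp_sub_right c)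
    simp only [sub_add_cancel] at h
    refine h.congr ?_
    rw [uIoc_of_le hp'q']
    intro ϑ hϑ
    simp only [abs_of_nonneg (show 0 ≤ ϑ - c by linarith [hϑ.1])]
  have main : ∀ p' q' : ℝ, p' ≤ q' → IntervalIntegrable (fun ϑ : ℝ => |ϑ - c| ^ (-(1 / 2) : ℝ)) volume p' q' := by
    intro p' q' hpq
    rcases le_total c p' with hcp | hpc
    · exact key' p' q' hpq hcp
    rcases le_total q' c with hqc | hcq
    · exact key p' q' hpq hqc
    · exact (key p' c hpc le_rfl).trans (key' c q' hcq le_rfl)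
  rcases le_total p q with hpq | hqp
  · exact main p q hpq
  · exact (main q p hqp).symm

/-- **THE DISPATCHER WITH THE LOGARITHMIC REMAINDER.**  As `intervalIntegral_caustic_dispatch_remainder_le`, the two laws carrying the remainder
`B′·log(Γ/|m ϑ|)` (`0 ≤ B′`, `|m| ≤ Γ` on the window; e.g. the `½log⁺(cL²/δ₀)` of `…C4aPreCausticAngleLayer` after `log((√cL+√δ₀)/√δ₀) ≤ log 2 + ½log⁺(cL²/δ₀)`,
with `log⁺ ≤ log(Γ/|δ₀|)` for `Γ ≥ max(cL², sup|δ₀|)`).  THEN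
`∫_α^β F ≤ (8A + 4P)/√(κ/2) + B·(β − α) + B′·2(Γ/(κ/2))^{1/4}·8√(β − α)`: the logarithm is majorised INTERNALLY at the sign pair by two inverse square roots
(`log_offset_le_rpow_sum`, valid off `e₁, e₂` — exactly the points the engine never asks about), each integrable across its zero uniformly
(`intervalIntegral_abs_sub_rpow_neg_half_le`) — nothing about the zeros reaches the caller; `n`-free and θ-uniform through an antipodal-umklapp touch. -/
theorem intervalIntegral_caustic_dispatch_log_le {F m : ℝ → ℝ} {α β κ lo A P B B' Γ : ℝ} (hαβ : α ≤ β) (hκ : 0 < κ) (hlo : 0 < lo)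
    (hA : 0 ≤ A) (hP : 0 ≤ P) (hB : 0 ≤ B) (hB' : 0 ≤ B') (hΓ : 0 ≤ Γ)
    (hφ : ConvexOn ℝ (Icc α β) (fun ϑ => m ϑ - κ / 2 * ϑ ^ 2)) (hcont : ContinuousOn m (Icc α β))
    (hmΓ : ∀ ϑ ∈ Icc α β, |m ϑ| ≤ Γ)
    (hF0 : ∀ ϑ ∈ Icc α β, 0 ≤ F ϑ)
    (hpre : ∀ ϑ ∈ Ioo α β, 0 < m ϑ →
      F ϑ ≤ A * (lo * ((max |m ϑ| lo)⁻¹ * (Real.sqrt (max |m ϑ| lo))⁻¹)) + B + B' * Real.log (Γ / |m ϑ|))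
    (hpost : ∀ ϑ ∈ Ioo α β, m ϑ < 0 → F ϑ ≤ P * (Real.sqrt |m ϑ|)⁻¹ + B + B' * Real.log (Γ / |m ϑ|)) :
    ∫ ϑ in α..β, F ϑ ≤ (8 * A + 4 * P) / Real.sqrt (κ / 2) + B * (β - α) +
      B' * (2 * (Γ / (κ / 2)) ^ (1 / 4 : ℝ)) * (8 * Real.sqrt (β - α)) := by
  obtain ⟨e₁, e₂, hαe, h12, heβ, hleft, hright, hin, hprod⟩ := exists_signPair_of_convexOn_sub_sq hαβ hκ hφ hcont
  have hb : 0 < κ / 2 := by positivity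
  -- the internal remainder majorant
  set R : ℝ → ℝ := fun ϑ => B' * (2 * (Γ / (κ / 2)) ^ (1 / 4 : ℝ) * (|ϑ - e₁| ^ (-(1 / 2) : ℝ) + |ϑ - e₂| ^ (-(1 / 2) : ℝ))) with hRdef
  have hC : 0 ≤ (Γ / (κ / 2)) ^ (1 / 4 : ℝ) := Real.rpow_nonneg (div_nonneg hΓ hb.le) _
  have hR0 : ∀ ϑ : ℝ, 0 ≤ R ϑ := fun ϑ => by
    have h1 : 0 ≤ |ϑ - e₁| ^ (-(1 / 2) : ℝ) := Real.rpow_nonneg (abs_nonneg _) _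
    have h2 : 0 ≤ |ϑ - e₂| ^ (-(1 / 2) : ℝ) := Real.rpow_nonneg (abs_nonneg _) _
    simp only [hRdef]
    positivity
  have hi₁ := intervalIntegrable_abs_sub_rpow_neg_half e₁ α β
  have hi₂ := intervalIntegrable_abs_sub_rpow_neg_half e₂ α β
  have hRi : IntervalIntegrable R volume α β := ((hi₁.add hi₂).const_mul _).const_mul B'
  -- off `e₁, e₂` the logarithm is below the majorant
  have hlogR : ∀ ϑ ∈ Ioo α β, ϑ ≠ e₁ → ϑ ≠ e₂ → B' * Real.log (Γ / |m ϑ|) ≤ R ϑ := fun ϑ hϑ hn1 hn2 => by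
    have hϑI : ϑ ∈ Icc α β := Ioo_subset_Icc_self hϑ
    have h := log_offset_le_rpow_sum hb hn1 hn2 (hprod ϑ hϑI) (hmΓ ϑ hϑI)
    simp only [hRdef]
    exact mul_le_mul_of_nonneg_left h hB'
  have hmain := intervalIntegral_caustic_dispatch_le_of_signPair (R := R) hαe h12 heβ hb hlo hA hP hB
    (fun ϑ hϑ => hleft ϑ ⟨hϑ.1.le, hϑ.2.le.trans (h12.trans heβ)⟩ hϑ.2)
    (fun ϑ hϑ => hright ϑ ⟨(hαe.trans h12).trans hϑ.1.le, hϑ.2.le⟩ hϑ.1)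
    hin hF0 (fun ϑ _ => hR0 ϑ) hRi
    (fun ϑ hϑ hn1 hn2 hm => (hpre ϑ hϑ hm).trans (by linarith [hlogR ϑ hϑ hn1 hn2]))
    (fun ϑ hϑ hn1 hn2 hm => (hpost ϑ hϑ hm).trans (by linarith [hlogR ϑ hϑ hn1 hn2]))
  -- the remainder integral
  have hRval : ∫ ϑ in α..β, R ϑ ≤ B' * (2 * (Γ / (κ / 2)) ^ (1 / 4 : ℝ)) * (8 * Real.sqrt (β - α)) := by
    simp only [hRdef]
    rw [intervalIntegral.integral_const_mul, intervalIntegral.integral_const_mul, intervalIntegral.integral_add hi₁ hi₂]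
    have h1 := intervalIntegral_abs_sub_rpow_neg_half_le (p := α) (q := β) (c := e₁) hαe (h12.trans heβ)
    have h2 := intervalIntegral_abs_sub_rpow_neg_half_le (p := α) (q := β) (c := e₂) (hαe.trans h12) heβ
    have hcoef : 0 ≤ B' * (2 * (Γ / (κ / 2)) ^ (1 / 4 : ℝ)) := by positivity
    calc B' * (2 * (Γ / (κ / 2)) ^ (1 / 4 : ℝ) * ((∫ ϑ in α..β, |ϑ - e₁| ^ (-(1 / 2) : ℝ)) + ∫ ϑ in α..β, |ϑ - e₂| ^ (-(1 / 2) : ℝ)))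
        = B' * (2 * (Γ / (κ / 2)) ^ (1 / 4 : ℝ)) * ((∫ ϑ in α..β, |ϑ - e₁| ^ (-(1 / 2) : ℝ)) + ∫ ϑ in α..β, |ϑ - e₂| ^ (-(1 / 2) : ℝ)) := by
          ring
      _ ≤ B' * (2 * (Γ / (κ / 2)) ^ (1 / 4 : ℝ)) * (8 * Real.sqrt (β - α)) := by
          refine mul_le_mul_of_nonneg_left ?_ hcoef
          linarith
  linarith [hmain, hRval]

end Summit.HubbardSuperconductivity.HubbardSuperconductivity.Theorems.C4a

end
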